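import Summits.QuantumFields.GaugeBoot.TiltedLatticeGauge
import HarnessLib

/-!
# Translation invariance of the Wilson measure of a periodic lattice (gauge-boot, L3(σ) supplement)

HONEST FRAMING (cell `pub-gaugeboot`, page 1 of every file): the venture produces certified bounds
on lattice expectations at stated coupling, gauge group, dimension and torus size; NOT a mass gap,
NOT a continuum limit, NOT a string tension; NOT Yang–Mills-summit-bearing (barriers
`FixedCouplingUltralocality`, `PerturbativeInvisibility`).

Supplement to `TiltedLatticeGauge.lean` (Wilson theory on a periodic lattice: finite additive
commutative site group `A`, marked translations `e : Fin d → A`, Wilson measure `gibbs ρ e β`). The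
site group acts on itself by translations `x ↦ x + a`; this module records that the Wilson action
and the Wilson measure are invariant:

* `translate a U (x, k) = U (x + a, k)` — the translated configuration;
* `holonomy_translate`, `wilsonAction_translate` — `S(τ_a U) = S(U)` (the plaquette sum is
  re-indexed by `p ↦ p + a`);
* `measurePreserving_translate` — `τ_a` preserves the product Haar measure (a relabelling of the
  links) and `integral_comp_translate_gibbs` — `∫ F(τ_a U) dμ_β(U) = ∫ F dμ_β` for every measurable
  real or complex `F`, every `a ∈ A` and every real `β`.

For the 45°-tilted periodic box of `TiltedBox.lean` this is the translation invariance the loop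
equation / positivity bootstrap uses to identify Wilson loops at different base points; together
with `tiltedBox_diagonalRP` and `tiltedBox_integral_comp_configSwap` it lists the exact symmetry and
positivity input available on that finite periodic lattice (site/link reflection positivity along
the axes `k ∉ {i, j}` being the usual torus statements).

References: E. Seiler, LNP 159 (1982) Ch. 1; K. Wilson, Phys. Rev. D 10 (1974) 2445.
-/

noncomputable section

open MeasureTheory
open Literature.MathematicalPhysics.QuantumFieldTheory (haarProbability)
open Literature.RepresentationTheory.CompactGroups

namespace Summit.QuantumFields.GaugeBoot

namespace TiltedRP

variable {A : Type*} [AddCommGroup A] {d N : ℕ} {G : Type*}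

/-! ## Translations of configurations -/

/-- The translated configuration `(τ_a U)(x, k) = U(x + a, k)`. -/
def translate (a : A) (U : Config A d G) : Config A d G := fun l => U (l.1 + a, l.2)

/-- `translate` evaluated. -/
@[simp] theorem translate_apply (a : A) (U : Config A d G) (l : Link A d) :
    translate a U l = U (l.1 + a, l.2) := rfl

variable [Group G]

/-- **Holonomies of the translated configuration**: `(τ_a U)_{x;k,l} = U_{x+a;k,l}`. -/
theorem holonomy_translate (e : Fin d → A) (a : A) (U : Config A d G) (x : A) (k l : Fin d) :
    holonomy e (translate a U) x k l = holonomy e U (x + a) k l := by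
  simp only [holonomy, translate_apply, add_right_comm _ _ a]

variable (ρ : G →* Matrix (Fin N) (Fin N) ℂ)

/-- Plaquette observables of the translated configuration. -/
theorem plaqObs_translate (e : Fin d → A) (a : A) (p : Plaq A d) (U : Config A d G) :
    plaqObs ρ e p (translate a U) = plaqObs ρ e (p.1 + a, p.2) U := by
  simp only [plaqObs, holonomy_translate]

/-- The translation of plaquettes `p ↦ p + a` as a permutation. -/
def plaqShift (a : A) : Equiv.Perm (Plaq A d) where
  toFun p := (p.1 + a, p.2)
  invFun p := (p.1 - a, p.2)
  left_inv p := by simp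
  right_inv p := by simp

/-- **The Wilson action is translation invariant**: `S(τ_a U) = S(U)`. -/
theorem wilsonAction_translate [Fintype A] (e : Fin d → A) (a : A) (U : Config A d G) :
    wilsonAction ρ e (translate a U) = wilsonAction ρ e U := by
  unfold wilsonAction
  simp_rw [plaqObs_translate]
  exact Fintype.sum_equiv (plaqShift a) _ _ fun p => rfl

/-- The translation of links `(x, k) ↦ (x + a, k)` as a permutation. -/
def linkShift (a : A) : Equiv.Perm (Link A d) where
  toFun l := (l.1 + a, l.2)
  invFun l := (l.1 - a, l.2)
  left_inv l := by simp
  right_inv l := by simp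

section Measure

variable [Fintype A] [TopologicalSpace G] [IsTopologicalGroup G] [CompactSpace G] [MeasurableSpace G]
  [BorelSpace G]

omit [Group G] [Fintype A] [TopologicalSpace G] [IsTopologicalGroup G] [CompactSpace G] [BorelSpace G] in
/-- `translate a` is the relabelling of links by `linkShift a`. -/
theorem translate_eq_arrowCongr (a : A) :
    (translate (G := G) (d := d) a : Config A d G → Config A d G) =
      ⇑(MeasurableEquiv.arrowCongr' (linkShift (d := d) a).symm (MeasurableEquiv.refl G)) := by
  funext U l; rfl

/-- **Translations preserve the product Haar measure** (a relabelling of the links). -/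
theorem measurePreserving_translate (a : A) :
    MeasurePreserving (translate (G := G) (d := d) a) (productHaar A d G) (productHaar A d G) := by
  haveI : IsProbabilityMeasure (haarProbability G) :=
    CompactGroup.isProbabilityMeasure_haarMeasure_top
  have h := measurePreserving_arrowCongr' (fun _ : Link A d => haarProbability G)
    (fun _ : Link A d => haarProbability G) (linkShift (d := d) a).symm (MeasurableEquiv.refl G)
    fun _ => MeasurePreserving.id _
  rw [translate_eq_arrowCongr]
  exact h

variable [SecondCountableTopology G]

/-- **Translation invariance of the Wilson measure of a periodic lattice**:
`∫ F(τ_a U) dμ_β(U) = ∫ F dμ_β` for every measurable real `F`, every `a ∈ A`, every real `β`. -/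
theorem integral_comp_translate_gibbs (hρ : Continuous ρ) (e : Fin d → A) (β : ℝ) (a : A)
    {F : Config A d G → ℝ} (hFm : Measurable F) :
    ∫ U, F (translate a U) ∂(gibbs ρ e β) = ∫ U, F U ∂(gibbs ρ e β) := by
  rw [integral_gibbs, integral_gibbs]
  set Z := ∫ U, Real.exp (-β * wilsonAction ρ e U) ∂(productHaar A d G)
  have h1 : ∀ U : Config A d G, (Real.exp (-β * wilsonAction ρ e U) / Z) • F (translate a U) =
      (fun V : Config A d G => (Real.exp (-β * wilsonAction ρ e V) / Z) • F V) (translate a U) := by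
    intro U
    simp only [wilsonAction_translate]
  have hm : Measurable fun V : Config A d G => (Real.exp (-β * wilsonAction ρ e V) / Z) • F V :=
    (((continuous_boltzmann ρ hρ e β).measurable).div_const _).smul hFm
  simp_rw [h1]
  rw [← integral_map (measurePreserving_translate a).measurable.aemeasurable hm.aestronglyMeasurable,
    (measurePreserving_translate (G := G) (d := d) a).map_eq]

/-- Translation invariance for complex observables. -/
theorem integral_comp_translate_gibbs_complex (hρ : Continuous ρ) (e : Fin d → A) (β : ℝ) (a : A)
    {F : Config A d G → ℂ} (hFm : Measurable F) :
    ∫ U, F (translate a U) ∂(gibbs ρ e β) = ∫ U, F U ∂(gibbs ρ e β) := by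
  rw [integral_gibbs, integral_gibbs]
  set Z := ∫ U, Real.exp (-β * wilsonAction ρ e U) ∂(productHaar A d G)
  have h1 : ∀ U : Config A d G, (Real.exp (-β * wilsonAction ρ e U) / Z) • F (translate a U) =
      (fun V : Config A d G => (Real.exp (-β * wilsonAction ρ e V) / Z) • F V) (translate a U) := by
    intro U
    simp only [wilsonAction_translate]
  have hm : Measurable fun V : Config A d G => (Real.exp (-β * wilsonAction ρ e V) / Z) • F V :=
    (((continuous_boltzmann ρ hρ e β).measurable).div_const _).smul hFm
  simp_rw [h1]
  rw [← integral_map (measurePreserving_translate a).measurable.aemeasurable hm.aestronglyMeasurable,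
    (measurePreserving_translate (G := G) (d := d) a).map_eq]

end Measure

end TiltedRP

end Summit.QuantumFields.GaugeBoot
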